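import Summits.Ventures.PercRepro.S2ThirteenElevenNuSevenFourteenTop

/-!
# PercRepro — S2: Part (b) of the case `ν = 7` of the coloop-free cell `(13, 11)` — THE CELL SIDE (p7, gen 19; sub-claim S2; the row `p = 13`)

A set `V` of nullity `8` on `14` points (a rank-`6` flat: no set of nullity `9` on `≤ 15` points), in the regime `ν = 7` (rank-`5` sets `≤ 12`, rank-`4` sets `≤ 10` points): the exact-rank lever on `V` with `N = M ／ V` a loopless coloop-free matroid of nullity `3` on `10` points counted through ONE DELETION (`10 < 2·7`; `D₂ ≤ 3`, `D₃ ≤ 34`, `Q₃¹ ≤ 1`). The trace side by the rank classes of the `j`-subsets of `V` (S2RankClasses: `Dep₄ ≤ I₃`,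
`5·R₅³ ≤ 2·Dep₄`, `15·R₆³ ≤ Dep₄`, lines `≤ 3`, planes `≤ 6` points); the tail by flats at `(12, 10)` (`24090719819 / 41454`), the spanning
count through `V` (`≤ 2395823`). `#U ≤ 306069` (one omega per size, `6 … 11`), `m = 182`, ratio `0.61`. **`c025_thirteen_eleven_cf_nu_seven_fourteen`**. Nothing about the
cell is claimed. Axioms: standard.
The top count `#U` is the theorem of S2ThirteenElevenNuSevenFourteenTop; here the spanning count, the tail by flats and the cell inequality.
-/

open scoped Matroid

namespace PercRepro

namespace ThmN

open Set

variable {α : Type}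

/-- **Part (b) of the case `ν = 7` of the coloop-free cell `(13, 11)`**: a set `V` of nullity `8` on `14` points (a rank-`6` flat: no set of nullity `9` on `≤ 15` points), in the regime `ν = 7` (rank-`5` sets `≤ 12`, rank-`4` sets `≤ 10` points): the exact-rank lever on `V` with `N = M ／ V` a loopless coloop-free matroid of nullity `3` on `10` points counted through ONE DELETION (`10 < 2·7`; `D₂ ≤ 3`, `D₃ ≤ 34`, `Q₃¹ ≤ 1`) (`#U ≤ 306069`, `m = 182`). -/
theorem c025_thirteen_eleven_cf_nu_seven_fourteen (M : Matroid α) [M.Finite]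
    (hR : M.eRank = ((13 : ℕ) : ℕ∞)) (hn : M.E.ncard = 13 + 11)
    (hfree : ∀ e ∈ M.E, ∃ A ⊆ M.E \ {e}, e ∉ M.closure A ∧ e ∉ M.closure ((M.E \ {e}) \ A)) (hK : ∀ e, ¬ M.IsColoop e)
    (hno15 : ¬ ∃ W ⊆ M.E, W.ncard ≤ 15 ∧ W.encard = M.eRk W + 9)
    (h8 : ¬ ∃ W ⊆ M.E, W.ncard ≤ 13 ∧ W.encard = M.eRk W + 8)
    (hV : ∃ V ⊆ M.E, V.ncard = 14 ∧ V.encard = M.eRk V + 8) :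
    RLS M 13 5 := by
  classical
  have hU' := c025_thirteen_eleven_cf_nu_seven_fourteen_top M hR hn hfree hK hno15 h8 hV
  have hd : M.E.encard = M.eRank + ((11 : ℕ) : ℕ∞) := by
    rw [hR, ← M.ground_finite.cast_ncard_eq, hn]
    push_cast
    ring
  obtain ⟨hs3, hs4, hs5⟩ := caps_thirteen_eleven_cf M hd hn hfree hK
  have hEfin := M.ground_finite
  have hL0 : ∀ e ∈ M.E, ¬ M.IsLoop e := not_isLoop_of_free M hfree
  have hs : ∀ e ∈ M.E, ∀ f ∈ M.E, e ≠ f → M.eRk {e, f} = 2 := by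
    intro e he f hf hef
    have h2 : (2 : ℕ∞) ≤ M.eRk {e, f} :=
      two_le_eRk_of_two_le_ncard_of_free M hfree (pair_subset he hf) (by rw [ncard_pair hef])
    have h3 : M.eRk {e, f} ≤ 2 := by
      have := M.eRk_le_encard {e, f}
      rwa [encard_pair hef] at this
    exact le_antisymm h3 h2
  have hC1 : ∀ L ⊆ M.E, M.eRk L = 2 → L.ncard ≤ 3 :=
    fun L hL hr => ncard_le_three_of_eRk_two M hs hfree hL hr
  have hflat : ∀ X ⊆ M.E, M.eRk X ≤ 5 → X.ncard ≤ 12 := fun X hX hr => by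
    have := S2.ncard_le_of_eRk_le_of_not_nullity M 8 13 (by norm_num) h8 hX (r := 5) (by norm_num) (by exact_mod_cast hr)
    omega
  have hflat' : ∀ X ⊆ M.E, M.eRk X ≤ 4 → X.ncard ≤ 10 := fun X hX hr => ncard_le_ten_of_eRk_le_four_of_free M hfree hX hr
  -- the set `V`: `14` points of nullity `8` (rank `6`), a flat
  obtain ⟨V, hV, hw, hVk⟩ := hV
  have hVfin0 : V.Finite := hEfin.subset hV
  have hVne : M.eRk V ≠ ⊤ := ((M.eRk_le_encard V).trans_lt hVfin0.encard_lt_top).ne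
  have hr : M.eRk V = ((6 : ℕ) : ℕ∞) := by
    have h := hVk
    rw [← hVfin0.cast_ncard_eq, hw] at h
    have h2 : ((14 : ℕ) : ℕ∞) = ((6 : ℕ) : ℕ∞) + 8 := by norm_num
    rw [h2] at h
    exact (WithTop.add_right_cancel (by decide) h).symm
  have hVcl : M.closure V = V := by
    refine le_antisymm ?_ (M.subset_closure V hV)
    intro x hx
    by_contra hxV
    have hxE : x ∈ M.E := M.closure_subset_ground V hx
    apply hno15
    refine ⟨insert x V, Set.insert_subset hxE hV, ?_, ?_⟩
    · rw [Set.ncard_insert_of_notMem hxV hVfin0]; omega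
    · rw [Set.encard_insert_of_notMem hxV, ← M.eRk_closure_eq, M.closure_insert_eq_of_mem_closure hx,
        M.eRk_closure_eq, hVk]
      ring
  have hVE : V ⊆ M.E := hV
  have hS := S2.ncard_spanning_le_of_nullity M hVE hd hVk
  rw [hn, hw] at hS
  have hS' : {X : Set α | X ⊆ M.E ∧ M.eRk X = M.eRank}.ncard ≤ 2395823 := hS.trans (by decide)
  have hA := ncard_eRk_le_five_le_flats M 13 11 (by norm_num) hR hn hfree 12 10 hflat hflat' (by norm_num) (by norm_num)
    (by norm_num) (by norm_num) 24 225 1917 hs3 hs4 hs5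
  have hA' : ({X : Set α | X ⊆ M.E ∧ M.eRk X ≤ 5}.ncard : ℚ) ≤ 24090719819 / 41454 := by
    norm_num [Finset.sum_range_succ, Nat.choose] at hA
    linarith only [hA]
  rw [RLS_iff]
  exact c025_core_five_cell_of_counts_xqictq5g M 13 11 (by norm_num) hR hn 306069 hU' _ hA' 2395823 hS'
    9480 (by norm_num) (phiK 13 5) (by rw [phiK_thirteen_five]; norm_num) ⟨182, by norm_num, by norm_num, by norm_num⟩

end ThmN

end PercRepro
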